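import Literature.AlgebraicGeometry.HodgeTheory.DworkSexticJacobianInvariantLine
import Literature.AlgebraicGeometry.HodgeTheory.DworkSexticFlatEigenclassesHodgeType
import Literature.AlgebraicGeometry.Motives.UniversalHypersurfaceTorusAction
import HarnessLib

/-!
# Multiplication by `u = ∏ xᵢ` is injective on the `Γ_W`-invariant line of the Jacobian ring of the
# Dwork sextic, and the invariant exponents are the balanced ones

Family `hodge`, layer `Literature/AlgebraicGeometry/HodgeTheory`; theorems only (no definition, no named
fact; D-0026). Sequel to `DworkSexticJacobianInvariantLine` (`u^j ∉ J(F_ψ)` for `j ≤ 4` and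
`x^{6a+k𝟙} ≡ ψ^{|a|} u^{|a|+k} (mod J(F_ψ))`, for EVERY `ψ ∈ ℂ`). Written for the crux
`GenericInvariantHodgeClasses` (stmt-HodgeConjecture-24129) of route `HodgeConjecture/DworkReflectionQuotients`.

* `prod_X_mul_mem_jacobianIdeal_iff` — for a form `P` supported on balanced exponents of degree `6j`,
  `j ≤ 3`: `u·P ∈ J(F_ψ) ↔ P ∈ J(F_ψ)`. Through Griffiths' `R_F^{6(q+1)−6} ≅ H^{4−q,q}_prim` and
  `∇̄_{∂/∂ψ} = ·(∂F_ψ/∂ψ) = ·(−6u)` (Voisin II Cor. 6.12, Thm. 6.13) this is the INJECTIVITY of the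
  infinitesimal variation of Hodge structure on each graded piece of the `Γ_W`-invariant part `H[0]` of
  `H⁴_prim(X_ψ)` — at every point `ψ` of the Dwork line (no exceptional set).
* `forall_unitWeight_eq_one_iff_balanced` — an exponent `e` has weight `a^e = 1` for every `a` in Katz's
  group `Γ_W = {a ∈ μ₆⁶ : ∏ aᵢ = 1}` (`DworkSextic.gammaW`; `Motives.UniversalHypersurface.unitWeight`, the
  weight by which `a` acts on the monomial `x^e`) iff `e` is balanced (`eᵢ ≡ e₀ mod 6` for all `i`): the
  `Γ_W`-fixed monomials (the set `M` of `DworkSexticEquivariantTransport` in degree `6`; the numerators of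
  the invariant piece in degrees `12, 18, 24`) are exactly the balanced ones.

## References

* [Katz2009] N. M. Katz, Another look at the Dwork family, Progr. Math. 270 (2009), §3 p. 92, Lemma 3.1.
* [VoisinHodgeII2003] C. Voisin, Hodge Theory and Complex Algebraic Geometry II (2003), Cor. 6.12,
  Thm. 6.13.
* [CarlsonGriffiths1980IVHS] J. Carlson, P. Griffiths, Infinitesimal variations of Hodge structure and the
  global Torelli problem, Journées de géométrie algébrique d'Angers (1980), §3.
-/

noncomputable section

open MvPolynomial Finset
open scoped BigOperators

namespace Literature.AlgebraicGeometry.HodgeTheory.DworkSextic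

open Literature.AlgebraicGeometry.Motives Literature.AlgebraicGeometry.Motives.UniversalHypersurface

/-! ### §1 Injectivity of `·u` on the invariant line -/

/-- **On the invariant line, multiplication by `u` is injective modulo `J(F_ψ)`**: for a form `P`
supported on balanced exponents of degree `6j`, `j ≤ 3`, `u·P ∈ J(F_ψ) ↔ P ∈ J(F_ψ)`. Through
Griffiths' `R^{6(q+1)−6} ≅ H^{4−q,q}_prim` and `∇̄_{∂/∂ψ} = ·(∂F_ψ/∂ψ) = ·(−6u)` (Voisin II Cor. 6.12,
Thm. 6.13) this is the injectivity of the infinitesimal variation of Hodge structure on every graded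
piece of the `Γ_W`-invariant part `H[0]` of `H⁴_prim(X_ψ)`, at every `ψ`.
[cite: VoisinHodgeII2003, Thm. 6.13] [cite: CarlsonGriffiths1980IVHS, §3] -/
theorem prod_X_mul_mem_jacobianIdeal_iff (ψ : ℂ) {j : ℕ} (hj : j ≤ 3) {P : MvPolynomial (Fin 6) ℂ}
    (hP : ∀ e ∈ P.support, (∀ l : Fin 6, e l % 6 = e 0 % 6) ∧ ∑ l : Fin 6, e l = 6 * j) :
    (∏ i : Fin 6, X i : MvPolynomial (Fin 6) ℂ) * P ∈ jacobianIdeal (form ψ) ↔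
      P ∈ jacobianIdeal (form ψ) := by
  classical
  -- `P ≡ c · u^j` with `c = Σ_e coeff_e(P) ψ^{j − e₀ mod 6}`
  set c : ℂ := ∑ e ∈ P.support, coeff e P * ψ ^ (j - e 0 % 6) with hc
  have hPc : P - C c * (∏ i : Fin 6, X i : MvPolynomial (Fin 6) ℂ) ^ j ∈ jacobianIdeal (form ψ) := by
    have hsum : P - C c * (∏ i : Fin 6, X i : MvPolynomial (Fin 6) ℂ) ^ j =
        ∑ e ∈ P.support, C (coeff e P) *
          (monomial e 1 - C (ψ ^ (j - e 0 % 6)) * (∏ i : Fin 6, X i : MvPolynomial (Fin 6) ℂ) ^ j) := by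
      conv_lhs => rw [P.as_sum]
      rw [hc, map_sum, Finset.sum_mul, ← Finset.sum_sub_distrib]
      refine Finset.sum_congr rfl fun e _ => ?_
      rw [show monomial e (coeff e P) = C (coeff e P) * monomial e 1 by rw [C_mul_monomial, mul_one],
        map_mul, mul_assoc, ← mul_sub]
    rw [hsum]
    exact Ideal.sum_mem _ fun e he => Ideal.mul_mem_left _ _
      (monomial_sub_C_mul_prod_X_pow_mem_jacobianIdeal ψ (by omega) e (hP e he).1 (hP e he).2)
  have huPc : (∏ i : Fin 6, X i : MvPolynomial (Fin 6) ℂ) * P -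
      C c * (∏ i : Fin 6, X i : MvPolynomial (Fin 6) ℂ) ^ (j + 1) ∈ jacobianIdeal (form ψ) := by
    have h := Ideal.mul_mem_left _ (∏ i : Fin 6, X i : MvPolynomial (Fin 6) ℂ) hPc
    rw [mul_sub, mul_left_comm, ← pow_succ'] at h
    exact h
  constructor
  · intro huP
    -- then `c · u^{j+1} ∈ J`, so `c = 0` (`u^{j+1} ∉ J`), so `P ∈ J`
    have hcu : C c * (∏ i : Fin 6, X i : MvPolynomial (Fin 6) ℂ) ^ (j + 1) ∈ jacobianIdeal (form ψ) := by
      have := Ideal.sub_mem _ huP huPc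
      rwa [sub_sub_cancel] at this
    have hc0 : c = 0 := by
      by_contra hc0
      apply prod_X_pow_not_mem_jacobianIdeal ψ (j := j + 1) (by omega)
      have h := Ideal.mul_mem_left _ (C c⁻¹) hcu
      rwa [← mul_assoc, ← map_mul, inv_mul_cancel₀ hc0, map_one, one_mul] at h
    rw [hc0, C_0, zero_mul, sub_zero] at hPc
    exact hPc
  · intro hPJ
    exact Ideal.mul_mem_left _ _ hPJ


/-! ### §2 Balanced exponents are exactly the `Γ_W`-invariant ones -/

/-- **`x^e` is fixed by every `a ∈ Γ_W = {a ∈ μ₆⁶ : ∏ aᵢ = 1}` iff `e` is balanced** (`eᵢ ≡ e₀ mod 6`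
for all `i`): the character `a ↦ a^e` of `μ₆⁶` is trivial on `Γ_W = ker ∏` iff `e mod 6` is a
multiple of `𝟙`. (`⇒`: test against `a = (ζ₆ at l, ζ₆⁻¹ at 0)`; `⇐`: `a^e = (∏ aᵢ)^k · ∏ (aᵢ⁶)^{qᵢ} = 1`.)
These are the exponents of the `Γ_W`-fixed sextic monomials `M` of `DworkSexticEquivariantTransport`
in degree `6` (`xᵢ⁶` and `u`) and of the numerator polynomials of the invariant piece `H[0]`.
[cite: Katz2009, §3 p. 92] -/
theorem forall_unitWeight_eq_one_iff_balanced (e : Fin (4 + 2) →₀ ℕ) :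
    (∀ a : gammaW, unitWeight ℂ 4 (a : Fin (4 + 2) → ℂˣ) e = 1) ↔ ∀ l : Fin 6, e l % 6 = e 0 % 6 := by
  have hprod : ∀ a : Fin (4 + 2) → ℂˣ, unitWeight ℂ 4 a e = ∏ l, a l ^ e l := fun a => by
    rw [unitWeight, Finsupp.prod_fintype _ _ (fun l => pow_zero _)]
  constructor
  · intro h l
    by_contra hne
    have hl0 : l ≠ 0 := fun h0 => hne (by rw [h0])
    -- a primitive sixth root of unity `z` and the element `(z at l, z⁻¹ at 0)` of `Γ_W`
    have hζ := Complex.isPrimitiveRoot_exp 6 (by norm_num)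
    obtain ⟨z, hz⟩ := hζ.isUnit (by norm_num)
    rw [← hz] at hζ
    have hz' : IsPrimitiveRoot z 6 := IsPrimitiveRoot.coe_units_iff.mp hζ
    have hz6 : z ^ 6 = 1 := hz'.pow_eq_one
    have hord : orderOf z = 6 := hz'.eq_orderOf.symm
    set a : Fin (4 + 2) → ℂˣ := Pi.mulSingle l z * Pi.mulSingle 0 z⁻¹ with ha
    have hal : a l = z := by
      rw [ha, Pi.mul_apply, Pi.mulSingle_eq_same, Pi.mulSingle_eq_of_ne hl0, mul_one]
    have ha0 : a 0 = z⁻¹ := by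
      rw [ha, Pi.mul_apply, Pi.mulSingle_eq_same, Pi.mulSingle_eq_of_ne hl0.symm, one_mul]
    have hane : ∀ l', l' ≠ l → l' ≠ 0 → a l' = 1 := fun l' h1 h2 => by
      rw [ha, Pi.mul_apply, Pi.mulSingle_eq_of_ne h1, Pi.mulSingle_eq_of_ne h2, one_mul]
    have hamem : a ∈ gammaW := by
      refine mem_gammaW_iff.mpr ⟨fun l' => ?_, ?_⟩
      · by_cases h1 : l' = l
        · rw [h1, hal, hz6]
        · by_cases h2 : l' = 0
          · rw [h2, ha0, inv_pow, hz6, inv_one]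
          · rw [hane l' h1 h2, one_pow]
      · simp only [ha, Pi.mul_apply, Finset.prod_mul_distrib, Finset.prod_pi_mulSingle',
          Finset.mem_univ, if_true, mul_inv_cancel]
    have hw := h ⟨a, hamem⟩
    rw [hprod] at hw
    change ∏ l', a l' ^ e l' = 1 at hw
    rw [← Finset.prod_erase_mul _ _ (Finset.mem_univ l),
      ← Finset.prod_erase_mul _ _ (Finset.mem_erase.mpr ⟨hl0.symm, Finset.mem_univ 0⟩),
      Finset.prod_eq_one (fun l' hl' => by
        rw [Finset.mem_erase, Finset.mem_erase] at hl'
        rw [hane l' hl'.2.1 hl'.1, one_pow]), one_mul, hal, ha0, inv_pow,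
      inv_mul_eq_one, pow_eq_pow_iff_modEq, hord] at hw
    exact hne hw.symm
  · intro hbal a
    obtain ⟨ha6, hap⟩ := mem_gammaW_iff.mp a.2
    rw [hprod]
    have hterm : ∀ l, (a : Fin (4 + 2) → ℂˣ) l ^ e l = (a : Fin (4 + 2) → ℂˣ) l ^ (e 0 % 6) := fun l => by
      conv_lhs => rw [← Nat.div_add_mod (e l) 6, pow_add, pow_mul, ha6, one_pow, one_mul, hbal l]
    rw [Finset.prod_congr rfl fun l _ => hterm l, Finset.prod_pow, hap, one_pow]

end Literature.AlgebraicGeometry.HodgeTheory.DworkSextic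

end
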